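import Literature.Geometry.Lorentzian.CoordDivergenceIdentity
import Mathlib.Analysis.InnerProductSpace.Basic
import Mathlib.Analysis.Calculus.ContDiff.RCLike
import HarnessLib

/-!
# The normalized acceleration field near a nondegenerate zero: radial principal part and bounded
# remainder

Pure analysis on a `2`-dimensional real inner product space `E`, the last local input of the
Poincaré–Hopf proof of the Gauss–Bonnet theorem. For metric components `G` on an open set `V`
(`MetricCoord.IsMetricOn`), a point `c ∈ V` at which `G_c(v, w) = ⟨Av, Aw⟩` (`A` a linear
automorphism), and a smooth vector field `Z` on `V` with `Z(c) = 0` and invertible differential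
`L = DZ(c)` (a nondegenerate zero), we PROVE (`IsMetricOn.exists_remainder_bound`) that on a
punctured ball around `c`:

* `q = G(Z, Z)` does not vanish, and the normalized acceleration field
  `Xf = (∇_Z Z − (div Z) Z)/G(Z, Z)` (`MetricCoord.covDAt`, `divAt` of
  `CoordDivergenceIdentity.lean`) is continuous;
* `‖Xf(x) − (−det L/‖AL(x − c)‖²)(x − c)‖ ≤ C_R` — the field has the RADIAL principal part
  `κ (x − c)/‖T(x − c)‖²` with `κ = −det L`, `T = A ∘ L`, and a bounded remainder, which is the
  hypothesis of the flux estimate `IndexFlux.abs_integral_fderiv_cutoff_sub_le`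
  (`IndexFluxLimit.lean`).

Ingredients (all elementary): Taylor estimates `Z(x) = L(x − c) + O(‖x − c‖²)`,
`DZ = L + O(‖x − c‖)` (`exists_taylor_bound`: local Lipschitz continuity of `DZ` and the mean
value inequality), `G = G_c + O(‖x − c‖)` (`IsMetricOn.exists_lipschitz_bound`), `Γ = O(1)`
(`IsMetricOn.exists_chrAt_bound`); hence `∇_Z Z − (div Z) Z = (L² − (tr L)L)(x − c) + O(‖x−c‖²)
= −det(L)(x − c) + O(‖x − c‖²)` by Cayley–Hamilton in dimension two
(`comp_self_sub_trace_smul_add_det_smul`), and `G(Z, Z) = ‖AL(x − c)‖² + O(‖x − c‖³) ≥ ‖AL(x−c)‖²/2`.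
No definitions, no named facts.

## References

* J. M. Lee, *Introduction to Riemannian Manifolds*, 2nd ed., Springer 2018, Ch. 9 (Gauss–Bonnet).
  [LeeRiemannianManifolds2018]
-/

noncomputable section

open Set Filter Metric ContinuousLinearMap
open scoped Topology RealInnerProductSpace ContDiff

namespace Literature.Geometry.Lorentzian

namespace MetricCoord

variable {E : Type*} [NormedAddCommGroup E] [InnerProductSpace ℝ E] [FiniteDimensional ℝ E]
  [CompleteSpace E] {G : E → E →L[ℝ] E →L[ℝ] ℝ} {V : Set E} {c : E} {Z : E → E}

/-! ### Taylor estimates at a zero -/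

omit [FiniteDimensional ℝ E] [CompleteSpace E] in
/-- **First-order Taylor estimates with quadratic remainder**: for `Z` smooth on the open set `V`
near `c`, `‖DZ(x) − DZ(c)‖ ≤ K‖x − c‖` and `‖Z(x) − Z(c) − DZ(c)(x − c)‖ ≤ K‖x − c‖²` on a ball
around `c` (local Lipschitz continuity of `DZ` and the mean value inequality). [folklore] -/
theorem exists_taylor_bound (hV : IsOpen V) (hc : c ∈ V) (hZ : ContDiffOn ℝ ∞ Z V) :
    ∃ K δ : ℝ, 0 ≤ K ∧ 0 < δ ∧ ball c δ ⊆ V ∧ ∀ x ∈ ball c δ,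
      ‖fderiv ℝ Z x - fderiv ℝ Z c‖ ≤ K * ‖x - c‖ ∧
        ‖Z x - Z c - fderiv ℝ Z c (x - c)‖ ≤ K * ‖x - c‖ ^ 2 := by
  have hZc : ContDiffAt ℝ ∞ Z c := (hZ c hc).contDiffAt (hV.mem_nhds hc)
  have h2i : ((1 + 1 : ℕ∞) : ℕ∞ω) ≤ ∞ := WithTop.coe_le_coe.mpr le_top
  have hDZ : ContDiffAt ℝ 1 (fderiv ℝ Z) c := hZc.fderiv_right (m := 1) h2i
  obtain ⟨K, t, ht, hlip⟩ := hDZ.exists_lipschitzOnWith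
  obtain ⟨δ, hδ, hball⟩ := Metric.mem_nhds_iff.1 (inter_mem ht (hV.mem_nhds hc))
  refine ⟨K, δ, K.2, hδ, fun x hx ↦ (hball hx).2, fun x hx ↦ ?_⟩
  have h1 : ∀ y ∈ ball c δ, ‖fderiv ℝ Z y - fderiv ℝ Z c‖ ≤ K * ‖y - c‖ := fun y hy ↦
    hlip.norm_sub_le (hball hy).1 (hball (mem_ball_self hδ)).1
  refine ⟨h1 x hx, ?_⟩
  -- mean value inequality for `h y = Z y - DZ(c)(y - c)` on the closed ball of radius `‖x - c‖`
  set s : Set E := closedBall c ‖x - c‖ with hs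
  have hsub : s ⊆ ball c δ := closedBall_subset_ball (mem_ball_iff_norm.1 hx)
  have hderiv : ∀ y ∈ s, HasFDerivWithinAt (fun y ↦ Z y - fderiv ℝ Z c (y - c))
      (fderiv ℝ Z y - fderiv ℝ Z c) s y := by
    intro y hy
    have hyV : y ∈ V := (hball (hsub hy)).2
    have hZd : DifferentiableAt ℝ Z y :=
      ((hZ y hyV).contDiffAt (hV.mem_nhds hyV)).differentiableAt (by simp)
    have h2 : HasFDerivAt (fun y : E ↦ fderiv ℝ Z c (y - c))
        ((fderiv ℝ Z c).comp (ContinuousLinearMap.id ℝ E)) y :=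
      (fderiv ℝ Z c).hasFDerivAt.comp y ((hasFDerivAt_id y).sub_const c)
    rw [ContinuousLinearMap.comp_id] at h2
    exact (hZd.hasFDerivAt.sub h2).hasFDerivWithinAt
  have hbound : ∀ y ∈ s, ‖fderiv ℝ Z y - fderiv ℝ Z c‖ ≤ K * ‖x - c‖ := fun y hy ↦
    (h1 y (hsub hy)).trans (mul_le_mul_of_nonneg_left (mem_closedBall_iff_norm.1 hy) K.2)
  have hmvt := (convex_closedBall c ‖x - c‖).norm_image_sub_le_of_norm_hasFDerivWithin_le
    hderiv hbound (mem_closedBall_self (norm_nonneg _)) (mem_closedBall_iff_norm.2 le_rfl)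
  simp only [sub_self, map_zero, sub_zero] at hmvt
  calc ‖Z x - Z c - fderiv ℝ Z c (x - c)‖ = ‖Z x - fderiv ℝ Z c (x - c) - Z c‖ := by abel_nf
    _ ≤ K * ‖x - c‖ * ‖x - c‖ := hmvt
    _ = K * ‖x - c‖ ^ 2 := by ring

omit [FiniteDimensional ℝ E] [CompleteSpace E] in
/-- **Lipschitz estimate for the metric components at a point**: `‖G x − G c‖ ≤ K ‖x − c‖` near
`c`. [folklore] -/
theorem IsMetricOn.exists_lipschitz_bound (hG : IsMetricOn G V) (hc : c ∈ V) :
    ∃ K δ : ℝ, 0 ≤ K ∧ 0 < δ ∧ ball c δ ⊆ V ∧ ∀ x ∈ ball c δ, ‖G x - G c‖ ≤ K * ‖x - c‖ := by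
  have h1 : ContDiffAt ℝ 1 G c := (hG.contDiffAt hc).of_le (by norm_num)
  obtain ⟨K, t, ht, hlip⟩ := h1.exists_lipschitzOnWith
  obtain ⟨δ, hδ, hball⟩ := Metric.mem_nhds_iff.1 (inter_mem ht (hG.mem_nhds hc))
  exact ⟨K, δ, K.2, hδ, fun x hx ↦ (hball hx).2, fun x hx ↦
    hlip.norm_sub_le (hball hx).1 (hball (mem_ball_self hδ)).1⟩

omit [FiniteDimensional ℝ E] in
/-- **The Christoffel map is bounded near a point of `V`.** [folklore] -/
theorem IsMetricOn.exists_chrAt_bound (hG : IsMetricOn G V) (hc : c ∈ V) :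
    ∃ K δ : ℝ, 0 ≤ K ∧ 0 < δ ∧ ∀ x ∈ ball c δ, ‖chrAt G x‖ ≤ K := by
  have hcont : Tendsto (fun x ↦ ‖chrAt G x‖) (𝓝 c) (𝓝 ‖chrAt G c‖) :=
    (continuous_norm.tendsto (chrAt G c)).comp (hG.contDiffAt_chrAt hc).continuousAt.tendsto
  have hev : ∀ᶠ x in 𝓝 c, ‖chrAt G x‖ ≤ ‖chrAt G c‖ + 1 :=
    (hcont.eventually_lt_const (lt_add_one ‖chrAt G c‖)).mono fun x hx ↦ le_of_lt hx
  obtain ⟨δ, hδ, hball⟩ := Metric.eventually_nhds_iff_ball.1 hev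
  exact ⟨‖chrAt G c‖ + 1, δ, by positivity, hδ, fun x hx ↦ hball x hx⟩

/-! ### The normalized acceleration near a nondegenerate zero -/

set_option maxHeartbeats 800000 in
-- the proof below is a long chain of elementary estimates
/-- **Radial principal part and bounded remainder of the normalized acceleration field at a
nondegenerate zero.** Let `G` be metric components on the open set `V` of a plane `E`
(`finrank E = 2`), `c ∈ V` with `G_c(v, w) = ⟨Av, Aw⟩` for a linear automorphism `A`, and `Z` a
smooth vector field on `V` with `Z(c) = 0` and invertible differential `L = DZ(c)`. Then on a
punctured ball around `c`: `q = G(Z, Z) ≠ 0`, the field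
`Xf = (∇_Z Z − (div Z) Z)/G(Z,Z)` (`covDAt`, `divAt`) is continuous, and
`‖Xf(x) − (−det L/‖A L(x − c)‖²)(x − c)‖ ≤ C_R`: by Taylor `Z(x) = L(x−c) + O(‖x−c‖²)`,
`DZ = L + O(‖x − c‖)`, `G = G_c + O(‖x−c‖)`, `Γ = O(1)`, so
`∇_Z Z − (div Z) Z = (L² − (tr L) L)(x − c) + O(‖x−c‖²) = −det(L)(x−c) + O(‖x−c‖²)`
(Cayley–Hamilton) and `G(Z,Z) = ‖AL(x−c)‖² + O(‖x−c‖³) ≥ ‖AL(x−c)‖²/2`. [folklore] -/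
theorem IsMetricOn.exists_remainder_bound (hG : IsMetricOn G V) (hc : c ∈ V)
    (h2 : Module.finrank ℝ E = 2) (A : E ≃L[ℝ] E) (hA : ∀ v w, G c v w = ⟪A v, A w⟫)
    (hZ : ContDiffOn ℝ ∞ Z V) (hZc : Z c = 0) (L : E ≃L[ℝ] E) (hL : fderiv ℝ Z c = L) :
    ∃ δ CR : ℝ, 0 < δ ∧ ball c δ ⊆ V ∧
      (∀ x ∈ ball c δ \ {c}, G x (Z x) (Z x) ≠ 0) ∧
      ContinuousOn (fun x ↦ (G x (Z x) (Z x))⁻¹ • (covDAt G Z x (Z x) - divAt G Z x • Z x))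
        (ball c δ \ {c}) ∧
      ∀ x ∈ ball c δ \ {c}, ‖(G x (Z x) (Z x))⁻¹ • (covDAt G Z x (Z x) - divAt G Z x • Z x) -
        ((-LinearMap.det (L : E →ₗ[ℝ] E)) / ‖A (L (x - c))‖ ^ 2) • (x - c)‖ ≤ CR := by
  -- primitive estimates
  obtain ⟨K₁, δ₁, hK₁, hδ₁, hV₁, hT⟩ := exists_taylor_bound hG.isOpen hc hZ
  obtain ⟨K₂, δ₂, hK₂, hδ₂, -, hGL⟩ := hG.exists_lipschitz_bound hc
  obtain ⟨K₃, δ₃, hK₃, hδ₃, hΓb⟩ := hG.exists_chrAt_bound hc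
  -- constants
  set m : ℝ := ‖(L.symm : E →L[ℝ] E)‖ with hm
  set a : ℝ := ‖(A.symm : E →L[ℝ] E)‖ with ha
  set nL : ℝ := ‖(L : E →L[ℝ] E)‖ with hnL
  set nG : ℝ := ‖G c‖ with hnG
  set τ : ℝ := ‖traceCLM E‖ with hτ
  set d : ℝ := |LinearMap.det (L : E →ₗ[ℝ] E)| with hd
  set Cq : ℝ := K₂ * (nL + 1) ^ 2 + nG * K₁ * (2 * nL + 1) with hCq
  set CN : ℝ := K₁ * (nL + 1) + nL * K₁ + K₃ * (nL + 1) ^ 2 + τ * K₁ * (nL + 1) + τ * nL * K₁ +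
    τ * K₃ * (nL + 1) ^ 2 with hCN
  have hCq0 : 0 ≤ Cq := by positivity
  have hCN0 : 0 ≤ CN := by positivity
  set δ : ℝ := min δ₁ (min δ₂ (min δ₃ (min 1 (min (1 / (K₁ + 1))
    (1 / (2 * Cq * (m * a) ^ 2 + 1)))))) with hδdef
  have hδ : 0 < δ := by positivity
  have hδ₁' : δ ≤ δ₁ := min_le_left _ _
  have hδ₂' : δ ≤ δ₂ := (min_le_right _ _).trans (min_le_left _ _)
  have hδ₃' : δ ≤ δ₃ := (min_le_right _ _).trans ((min_le_right _ _).trans (min_le_left _ _))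
  have hδ1 : δ ≤ 1 :=
    (min_le_right _ _).trans ((min_le_right _ _).trans ((min_le_right _ _).trans (min_le_left _ _)))
  have hδK : δ ≤ 1 / (K₁ + 1) := (min_le_right _ _).trans ((min_le_right _ _).trans
    ((min_le_right _ _).trans ((min_le_right _ _).trans (min_le_left _ _))))
  have hδC : δ ≤ 1 / (2 * Cq * (m * a) ^ 2 + 1) := (min_le_right _ _).trans ((min_le_right _ _).trans
    ((min_le_right _ _).trans ((min_le_right _ _).trans (min_le_right _ _))))
  have hδK' : K₁ * δ ≤ 1 := by
    have h1 : K₁ / (K₁ + 1) ≤ 1 := by rw [div_le_one (by positivity)]; linarith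
    calc K₁ * δ ≤ K₁ * (1 / (K₁ + 1)) := by gcongr
      _ = K₁ / (K₁ + 1) := mul_one_div _ _
      _ ≤ 1 := h1
  have hδC' : 2 * Cq * (m * a) ^ 2 * δ ≤ 1 := by
    have h1 : 2 * Cq * (m * a) ^ 2 / (2 * Cq * (m * a) ^ 2 + 1) ≤ 1 := by
      rw [div_le_one (by positivity)]; linarith
    calc 2 * Cq * (m * a) ^ 2 * δ ≤ 2 * Cq * (m * a) ^ 2 * (1 / (2 * Cq * (m * a) ^ 2 + 1)) := by
          gcongr
      _ = 2 * Cq * (m * a) ^ 2 / (2 * Cq * (m * a) ^ 2 + 1) := mul_one_div _ _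
      _ ≤ 1 := h1
  set CR : ℝ := 2 * CN * (m * a) ^ 2 + 2 * Cq * d * (m * a) ^ 4 with hCR
  have hballV : ball c δ ⊆ V := (ball_subset_ball hδ₁').trans hV₁
  -- pointwise estimates on the punctured ball
  have key : ∀ x ∈ ball c δ \ {c},
      ‖A (L (x - c))‖ ^ 2 ≤ 2 * G x (Z x) (Z x) ∧ 0 < ‖A (L (x - c))‖ ^ 2 ∧
      ‖x - c‖ ^ 2 ≤ (m * a) ^ 2 * ‖A (L (x - c))‖ ^ 2 ∧
      ‖(covDAt G Z x (Z x) - divAt G Z x • Z x) -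
          (-LinearMap.det (L : E →ₗ[ℝ] E)) • (x - c)‖ ≤ CN * ‖x - c‖ ^ 2 ∧
      |G x (Z x) (Z x) - ‖A (L (x - c))‖ ^ 2| ≤ Cq * ‖x - c‖ ^ 3 := by
    intro x hx
    obtain ⟨hxb, hxc⟩ := hx
    have hxc' : x ≠ c := hxc
    set u : E := x - c with hu
    have hu0 : u ≠ 0 := sub_ne_zero.2 hxc'
    have hun : 0 < ‖u‖ := norm_pos_iff.2 hu0
    have huδ : ‖u‖ < δ := mem_ball_iff_norm.1 hxb
    have hu1 : ‖u‖ ≤ 1 := huδ.le.trans hδ1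
    -- lower bounds through `L⁻¹`, `A⁻¹`
    have hmL : ‖u‖ ≤ m * ‖L u‖ := by
      calc ‖u‖ = ‖(L.symm : E →L[ℝ] E) (L u)‖ := by simp
        _ ≤ m * ‖L u‖ := (L.symm : E →L[ℝ] E).le_opNorm _
    have haA : ‖L u‖ ≤ a * ‖A (L u)‖ := by
      calc ‖L u‖ = ‖(A.symm : E →L[ℝ] E) (A (L u))‖ := by simp
        _ ≤ a * ‖A (L u)‖ := (A.symm : E →L[ℝ] E).le_opNorm _
    have hq₀pos : 0 < ‖A (L u)‖ ^ 2 := by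
      have : A (L u) ≠ 0 := by
        intro h0
        exact hu0 (L.injective (A.injective (by rw [h0, map_zero, map_zero])))
      positivity
    have hu2 : ‖u‖ ^ 2 ≤ (m * a) ^ 2 * ‖A (L u)‖ ^ 2 := by
      have hm0 : 0 ≤ m := norm_nonneg _
      have h1 : ‖u‖ ≤ m * a * ‖A (L u)‖ :=
        calc ‖u‖ ≤ m * ‖L u‖ := hmL
          _ ≤ m * (a * ‖A (L u)‖) := mul_le_mul_of_nonneg_left haA hm0
          _ = m * a * ‖A (L u)‖ := by ring
      calc ‖u‖ ^ 2 ≤ (m * a * ‖A (L u)‖) ^ 2 := pow_le_pow_left₀ (norm_nonneg u) h1 2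
        _ = (m * a) ^ 2 * ‖A (L u)‖ ^ 2 := by ring
    -- Taylor
    obtain ⟨hDZ, hZT⟩ := hT x (ball_subset_ball hδ₁' hxb)
    rw [hZc, sub_zero, hL] at hZT
    rw [hL] at hDZ
    have hLu : ‖L u‖ ≤ nL * ‖u‖ := (L : E →L[ℝ] E).le_opNorm u
    have hZ1 : ‖Z x - L u‖ ≤ K₁ * ‖u‖ ^ 2 := hZT
    have hZ1' : ‖Z x - L u‖ ≤ ‖u‖ := by
      calc ‖Z x - L u‖ ≤ K₁ * ‖u‖ ^ 2 := hZ1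
        _ = (K₁ * ‖u‖) * ‖u‖ := by ring
        _ ≤ (K₁ * δ) * ‖u‖ := by gcongr
        _ ≤ 1 * ‖u‖ := by gcongr
        _ = ‖u‖ := one_mul _
    have hZ2 : ‖Z x‖ ≤ (nL + 1) * ‖u‖ := by
      calc ‖Z x‖ = ‖L u + (Z x - L u)‖ := by abel_nf
        _ ≤ ‖L u‖ + ‖Z x - L u‖ := norm_add_le _ _
        _ ≤ nL * ‖u‖ + ‖u‖ := add_le_add hLu hZ1'
        _ = (nL + 1) * ‖u‖ := by ring
    have hGx : ‖G x - G c‖ ≤ K₂ * ‖u‖ := hGL x (ball_subset_ball hδ₂' hxb)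
    have hΓ : ‖chrAt G x‖ ≤ K₃ := hΓb x (ball_subset_ball hδ₃' hxb)
    -- `q₀ = ‖A L u‖² = G c (Lu)(Lu)`
    have hq₀ : G c (L u) (L u) = ‖A (L u)‖ ^ 2 := by
      rw [hA, real_inner_self_eq_norm_sq]
    -- `|q - q₀| ≤ Cq ‖u‖³`
    have hqd : |G x (Z x) (Z x) - ‖A (L u)‖ ^ 2| ≤ Cq * ‖u‖ ^ 3 := by
      have e : G x (Z x) (Z x) - ‖A (L u)‖ ^ 2 =
          (G x - G c) (Z x) (Z x) + (G c (Z x - L u) (Z x) + G c (L u) (Z x - L u)) := by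
        rw [← hq₀]
        simp only [_root_.sub_apply, map_sub]
        ring
      rw [e]
      have t1 : |(G x - G c) (Z x) (Z x)| ≤ K₂ * ‖u‖ * ((nL + 1) * ‖u‖) ^ 2 := by
        calc |(G x - G c) (Z x) (Z x)| ≤ ‖(G x - G c) (Z x)‖ * ‖Z x‖ :=
              (Real.norm_eq_abs _).symm.le.trans (((G x - G c) (Z x)).le_opNorm _)
          _ ≤ (‖G x - G c‖ * ‖Z x‖) * ‖Z x‖ := by
              gcongr; exact (G x - G c).le_opNorm _
          _ ≤ (K₂ * ‖u‖ * ((nL + 1) * ‖u‖)) * ((nL + 1) * ‖u‖) := by gcongr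
          _ = K₂ * ‖u‖ * ((nL + 1) * ‖u‖) ^ 2 := by ring
      have t2 : |G c (Z x - L u) (Z x)| ≤ nG * ‖u‖ * ((nL + 1) * ‖u‖) := by
        calc |G c (Z x - L u) (Z x)| ≤ ‖G c (Z x - L u)‖ * ‖Z x‖ :=
              (Real.norm_eq_abs _).symm.le.trans ((G c (Z x - L u)).le_opNorm _)
          _ ≤ (‖G c‖ * ‖Z x - L u‖) * ‖Z x‖ := by gcongr; exact (G c).le_opNorm _
          _ ≤ (nG * ‖u‖) * ((nL + 1) * ‖u‖) := by gcongr
          _ = nG * ‖u‖ * ((nL + 1) * ‖u‖) := by ring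
      have t3 : |G c (L u) (Z x - L u)| ≤ nG * (nL * ‖u‖) * ‖u‖ := by
        calc |G c (L u) (Z x - L u)| ≤ ‖G c (L u)‖ * ‖Z x - L u‖ :=
              (Real.norm_eq_abs _).symm.le.trans ((G c (L u)).le_opNorm _)
          _ ≤ (‖G c‖ * ‖L u‖) * ‖Z x - L u‖ := by gcongr; exact (G c).le_opNorm _
          _ ≤ (nG * (nL * ‖u‖)) * ‖u‖ := by gcongr
          _ = nG * (nL * ‖u‖) * ‖u‖ := by ring
      have hK₁u : ‖Z x - L u‖ ≤ K₁ * ‖u‖ ^ 2 := hZ1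
      -- sharper: use `K₁ ‖u‖²` in t2, t3
      have t2' : |G c (Z x - L u) (Z x)| ≤ nG * (K₁ * ‖u‖ ^ 2) * ((nL + 1) * ‖u‖) := by
        calc |G c (Z x - L u) (Z x)| ≤ ‖G c (Z x - L u)‖ * ‖Z x‖ :=
              (Real.norm_eq_abs _).symm.le.trans ((G c (Z x - L u)).le_opNorm _)
          _ ≤ (‖G c‖ * ‖Z x - L u‖) * ‖Z x‖ := by gcongr; exact (G c).le_opNorm _
          _ ≤ (nG * (K₁ * ‖u‖ ^ 2)) * ((nL + 1) * ‖u‖) := by gcongr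
          _ = nG * (K₁ * ‖u‖ ^ 2) * ((nL + 1) * ‖u‖) := by ring
      have t3' : |G c (L u) (Z x - L u)| ≤ nG * (nL * ‖u‖) * (K₁ * ‖u‖ ^ 2) := by
        calc |G c (L u) (Z x - L u)| ≤ ‖G c (L u)‖ * ‖Z x - L u‖ :=
              (Real.norm_eq_abs _).symm.le.trans ((G c (L u)).le_opNorm _)
          _ ≤ (‖G c‖ * ‖L u‖) * ‖Z x - L u‖ := by gcongr; exact (G c).le_opNorm _
          _ ≤ (nG * (nL * ‖u‖)) * (K₁ * ‖u‖ ^ 2) := by gcongr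
          _ = nG * (nL * ‖u‖) * (K₁ * ‖u‖ ^ 2) := by ring
      calc |(G x - G c) (Z x) (Z x) + (G c (Z x - L u) (Z x) + G c (L u) (Z x - L u))|
          ≤ |(G x - G c) (Z x) (Z x)| + (|G c (Z x - L u) (Z x)| + |G c (L u) (Z x - L u)|) :=
            (abs_add_le _ _).trans (add_le_add le_rfl (abs_add_le _ _))
        _ ≤ K₂ * ‖u‖ * ((nL + 1) * ‖u‖) ^ 2 + (nG * (K₁ * ‖u‖ ^ 2) * ((nL + 1) * ‖u‖) +
            nG * (nL * ‖u‖) * (K₁ * ‖u‖ ^ 2)) := add_le_add t1 (add_le_add t2' t3')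
        _ = Cq * ‖u‖ ^ 3 := by rw [hCq]; ring
    -- `q ≥ q₀ / 2`
    have hqlow : ‖A (L u)‖ ^ 2 ≤ 2 * G x (Z x) (Z x) := by
      have h1 : Cq * ‖u‖ ^ 3 ≤ ‖A (L u)‖ ^ 2 / 2 := by
        calc Cq * ‖u‖ ^ 3 = (Cq * ‖u‖) * ‖u‖ ^ 2 := by ring
          _ ≤ (Cq * δ) * ((m * a) ^ 2 * ‖A (L u)‖ ^ 2) := by gcongr
          _ = (2 * Cq * (m * a) ^ 2 * δ) * ‖A (L u)‖ ^ 2 / 2 := by ring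
          _ ≤ 1 * ‖A (L u)‖ ^ 2 / 2 := by gcongr
          _ = ‖A (L u)‖ ^ 2 / 2 := by ring
      have h2 := (abs_sub_le_iff.1 hqd).2
      linarith
    -- the numerator: `N - N₀`
    have hCH := comp_self_sub_trace_smul_add_det_smul h2 (L : E →L[ℝ] E)
    have hN₀ : (L : E →L[ℝ] E) ((L : E →L[ℝ] E) u) - traceCLM E (L : E →L[ℝ] E) • (L : E →L[ℝ] E) u =
        -LinearMap.det ((L : E →L[ℝ] E) : E →ₗ[ℝ] E) • u := by
      have := DFunLike.congr_fun hCH u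
      simp only [_root_.add_apply, _root_.sub_apply, ContinuousLinearMap.comp_apply,
        _root_.smul_apply, one_apply_eq_self, _root_.zero_apply] at this
      rw [neg_smul, eq_neg_iff_add_eq_zero]
      exact this
    have hNeq : covDAt G Z x (Z x) - divAt G Z x • Z x -
        (-LinearMap.det (L : E →ₗ[ℝ] E)) • u =
        ((fderiv ℝ Z x - (L : E →L[ℝ] E)) (Z x) + (L : E →L[ℝ] E) (Z x - L u)) + chrAt G x (Z x) (Z x) -
          traceCLM E (fderiv ℝ Z x - (L : E →L[ℝ] E)) • Z x - traceCLM E (L : E →L[ℝ] E) • (Z x - L u) -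
          traceCLM E (chrAt G x (Z x)) • Z x := by
      rw [show (LinearMap.det (L : E →ₗ[ℝ] E)) = LinearMap.det ((L : E →L[ℝ] E) : E →ₗ[ℝ] E)
        from rfl, ← hN₀, covDAt_apply, divAt_eq, covDAt]
      simp only [map_add, map_sub, _root_.sub_apply, add_smul, sub_smul, smul_sub]
      abel
    have hτ1 : ∀ P : E →L[ℝ] E, |traceCLM E P| ≤ τ * ‖P‖ := fun P ↦
      (Real.norm_eq_abs _).symm.le.trans ((traceCLM E).le_opNorm P)
    have hN : ‖covDAt G Z x (Z x) - divAt G Z x • Z x - (-LinearMap.det (L : E →ₗ[ℝ] E)) • u‖ ≤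
        CN * ‖u‖ ^ 2 := by
      rw [hNeq]
      have b1 : ‖(fderiv ℝ Z x - (L : E →L[ℝ] E)) (Z x)‖ ≤ K₁ * ‖u‖ * ((nL + 1) * ‖u‖) :=
        ((fderiv ℝ Z x - (L : E →L[ℝ] E)).le_opNorm _).trans (by gcongr)
      have b2 : ‖(L : E →L[ℝ] E) (Z x - L u)‖ ≤ nL * (K₁ * ‖u‖ ^ 2) :=
        ((L : E →L[ℝ] E).le_opNorm _).trans (by gcongr)
      have b3 : ‖chrAt G x (Z x) (Z x)‖ ≤ K₃ * ((nL + 1) * ‖u‖) * ((nL + 1) * ‖u‖) := by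
        calc ‖chrAt G x (Z x) (Z x)‖ ≤ ‖chrAt G x (Z x)‖ * ‖Z x‖ := (chrAt G x (Z x)).le_opNorm _
          _ ≤ (‖chrAt G x‖ * ‖Z x‖) * ‖Z x‖ := by gcongr; exact (chrAt G x).le_opNorm _
          _ ≤ (K₃ * ((nL + 1) * ‖u‖)) * ((nL + 1) * ‖u‖) := by gcongr
      have b4 : ‖traceCLM E (fderiv ℝ Z x - (L : E →L[ℝ] E)) • Z x‖ ≤ τ * (K₁ * ‖u‖) * ((nL + 1) * ‖u‖) := by
        rw [norm_smul, Real.norm_eq_abs]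
        calc |traceCLM E (fderiv ℝ Z x - (L : E →L[ℝ] E))| * ‖Z x‖ ≤ (τ * ‖fderiv ℝ Z x - ↑L‖) * ‖Z x‖ := by
              gcongr; exact hτ1 _
          _ ≤ (τ * (K₁ * ‖u‖)) * ((nL + 1) * ‖u‖) := by gcongr
      have b5 : ‖traceCLM E (L : E →L[ℝ] E) • (Z x - L u)‖ ≤ τ * nL * (K₁ * ‖u‖ ^ 2) := by
        rw [norm_smul, Real.norm_eq_abs]
        calc |traceCLM E (L : E →L[ℝ] E)| * ‖Z x - L u‖ ≤ (τ * nL) * ‖Z x - L u‖ := by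
              gcongr; exact hτ1 _
          _ ≤ (τ * nL) * (K₁ * ‖u‖ ^ 2) := by gcongr
      have b6 : ‖traceCLM E (chrAt G x (Z x)) • Z x‖ ≤ τ * (K₃ * ((nL + 1) * ‖u‖)) * ((nL + 1) * ‖u‖) := by
        rw [norm_smul, Real.norm_eq_abs]
        calc |traceCLM E (chrAt G x (Z x))| * ‖Z x‖ ≤ (τ * ‖chrAt G x (Z x)‖) * ‖Z x‖ := by
              gcongr; exact hτ1 _
          _ ≤ (τ * (‖chrAt G x‖ * ‖Z x‖)) * ‖Z x‖ := by gcongr; exact (chrAt G x).le_opNorm _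
          _ ≤ (τ * (K₃ * ((nL + 1) * ‖u‖))) * ((nL + 1) * ‖u‖) := by gcongr
      calc ‖(fderiv ℝ Z x - (L : E →L[ℝ] E)) (Z x) + (L : E →L[ℝ] E) (Z x - L u) +
            ((chrAt G x) (Z x)) (Z x) -
            traceCLM E (fderiv ℝ Z x - (L : E →L[ℝ] E)) • Z x -
            traceCLM E (L : E →L[ℝ] E) • (Z x - L u) -
            traceCLM E ((chrAt G x) (Z x)) • Z x‖
          ≤ ‖(fderiv ℝ Z x - (L : E →L[ℝ] E)) (Z x)‖ + ‖(L : E →L[ℝ] E) (Z x - L u)‖ +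
            ‖((chrAt G x) (Z x)) (Z x)‖ +
            ‖traceCLM E (fderiv ℝ Z x - (L : E →L[ℝ] E)) • Z x‖ +
            ‖traceCLM E (L : E →L[ℝ] E) • (Z x - L u)‖ +
            ‖traceCLM E ((chrAt G x) (Z x)) • Z x‖ := by
            refine (norm_sub_le _ _).trans ?_
            gcongr
            refine (norm_sub_le _ _).trans ?_
            gcongr
            refine (norm_sub_le _ _).trans ?_
            gcongr
            exact (norm_add_le _ _).trans (add_le_add (norm_add_le _ _) le_rfl)
        _ ≤ K₁ * ‖u‖ * ((nL + 1) * ‖u‖) + nL * (K₁ * ‖u‖ ^ 2) +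
            K₃ * ((nL + 1) * ‖u‖) * ((nL + 1) * ‖u‖) + τ * (K₁ * ‖u‖) * ((nL + 1) * ‖u‖) +
            τ * nL * (K₁ * ‖u‖ ^ 2) + τ * (K₃ * ((nL + 1) * ‖u‖)) * ((nL + 1) * ‖u‖) := by
            gcongr
        _ = CN * ‖u‖ ^ 2 := by rw [hCN]; ring
    exact ⟨hqlow, hq₀pos, hu2, hN, hqd⟩
  -- conclusions
  refine ⟨δ, CR, hδ, hballV, fun x hx ↦ ?_, ?_, fun x hx ↦ ?_⟩
  · obtain ⟨hql, hq0, -⟩ := key x hx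
    intro h0
    rw [h0, mul_zero] at hql
    linarith
  · -- continuity
    have hVo := hG.isOpen
    have hZc' : ContinuousOn Z V := hZ.continuousOn
    have hDZc : ContinuousOn (fderiv ℝ Z) V :=
      (hZ.continuousOn_fderiv_of_isOpen hVo (by simp)).mono le_rfl |>.mono subset_rfl
    have hGc' : ContinuousOn G V := hG.contDiffOn.continuousOn
    have hΓc : ContinuousOn (chrAt G) V := (hG.contDiffOn_chrAt).continuousOn
    have hsub : ball c δ \ {c} ⊆ V := sdiff_subset.trans hballV
    have hq : ContinuousOn (fun x ↦ G x (Z x) (Z x)) (ball c δ \ {c}) :=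
      ((hGc'.mono hsub).clm_apply (hZc'.mono hsub)).clm_apply (hZc'.mono hsub)
    have hcov : ContinuousOn (fun x ↦ covDAt G Z x) (ball c δ \ {c}) := by
      simp only [covDAt]
      exact (hDZc.mono hsub).add ((hΓc.mono hsub).clm_apply (hZc'.mono hsub))
    have hN1 : ContinuousOn (fun x ↦ covDAt G Z x (Z x)) (ball c δ \ {c}) :=
      hcov.clm_apply (hZc'.mono hsub)
    have hdiv : ContinuousOn (fun x ↦ divAt G Z x) (ball c δ \ {c}) := by
      simp only [divAt_eq]
      exact (traceCLM E).continuous.comp_continuousOn hcov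
    refine (hq.inv₀ fun x hx ↦ ?_).smul (hN1.sub (hdiv.smul (hZc'.mono hsub)))
    obtain ⟨hql, hq0, -⟩ := key x hx
    intro h0; rw [h0, mul_zero] at hql; linarith
  · obtain ⟨hql, hq0, hu2, hN, hqd⟩ := key x hx
    set u : E := x - c with hu
    set q : ℝ := G x (Z x) (Z x) with hqdef
    set q₀ : ℝ := ‖A (L u)‖ ^ 2 with hq₀def
    set N : E := covDAt G Z x (Z x) - divAt G Z x • Z x with hNdef
    set N₀ : E := (-LinearMap.det (L : E →ₗ[ℝ] E)) • u with hN₀def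
    have hqpos : 0 < q := by linarith
    have hqinv : q⁻¹ ≤ 2 / q₀ := by
      rw [inv_eq_one_div, div_le_div_iff₀ hqpos hq0]; linarith
    have hdecomp' : ∀ (P P₀ : E) (s t : ℝ), s • P - t • P₀ = s • (P - P₀) + (s - t) • P₀ := by
      intro P P₀ s t
      simp only [smul_sub, sub_smul]
      abel
    have hdecomp : q⁻¹ • N - ((-LinearMap.det (L : E →ₗ[ℝ] E)) / q₀) • u =
        q⁻¹ • (N - N₀) + (q⁻¹ - q₀⁻¹) • N₀ := by
      rw [hN₀def, div_eq_inv_mul, mul_smul]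
      exact hdecomp' N _ _ _
    rw [hdecomp]
    have hN₀norm : ‖N₀‖ = d * ‖u‖ := by rw [hN₀def, norm_smul, Real.norm_eq_abs, abs_neg]
    have e1 : ‖q⁻¹ • (N - N₀)‖ ≤ 2 * CN * (m * a) ^ 2 := by
      rw [norm_smul, Real.norm_eq_abs, abs_of_pos (inv_pos.2 hqpos)]
      calc q⁻¹ * ‖N - N₀‖ ≤ (2 / q₀) * (CN * ‖u‖ ^ 2) := by gcongr
        _ = 2 * CN * (‖u‖ ^ 2 / q₀) := by ring
        _ ≤ 2 * CN * (m * a) ^ 2 := by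
            gcongr
            rw [div_le_iff₀ hq0]; exact hu2
    have e2 : ‖(q⁻¹ - q₀⁻¹) • N₀‖ ≤ 2 * Cq * d * (m * a) ^ 4 := by
      rw [norm_smul, Real.norm_eq_abs, hN₀norm]
      have hdiff : |q⁻¹ - q₀⁻¹| = |q - q₀| / (q * q₀) := by
        rw [inv_sub_inv hqpos.ne' hq0.ne', abs_div, abs_of_pos (mul_pos hqpos hq0), abs_sub_comm]
      rw [hdiff]
      have hqq : ‖u‖ ^ 4 ≤ 2 * (m * a) ^ 4 * (q * q₀) := by
        have h1 : ‖u‖ ^ 2 ≤ (m * a) ^ 2 * q₀ := hu2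
        have h2 : (m * a) ^ 2 * q₀ ≤ (m * a) ^ 2 * (2 * q) := by gcongr
        nlinarith [norm_nonneg u, hq0.le, hqpos.le, sq_nonneg (m * a)]
      calc |q - q₀| / (q * q₀) * (d * ‖u‖) ≤ Cq * ‖u‖ ^ 3 / (q * q₀) * (d * ‖u‖) := by gcongr
        _ = Cq * d * (‖u‖ ^ 4 / (q * q₀)) := by ring
        _ ≤ Cq * d * (2 * (m * a) ^ 4) := by
            gcongr
            rw [div_le_iff₀ (mul_pos hqpos hq0)]; linarith
        _ = 2 * Cq * d * (m * a) ^ 4 := by ring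
    calc ‖q⁻¹ • (N - N₀) + (q⁻¹ - q₀⁻¹) • N₀‖ ≤ ‖q⁻¹ • (N - N₀)‖ + ‖(q⁻¹ - q₀⁻¹) • N₀‖ :=
          norm_add_le _ _
      _ ≤ 2 * CN * (m * a) ^ 2 + 2 * Cq * d * (m * a) ^ 4 := add_le_add e1 e2
      _ = CR := by rw [hCR]

end MetricCoord

end Literature.Geometry.Lorentzian

end
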